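import Summits.HodgeConjecture.HodgeConjecture.Theorems.HolomorphicityRateRateGapOfHodge
import Literature.AlgebraicGeometry.HodgeTheory.MiddleDimensionReductionHolds
import Literature.AlgebraicGeometry.HodgeTheory.HypersurfaceLefschetz
import HarnessLib

/-!
# Route `HolomorphicityRate`, crux `RateGap` (R1): the residual content of the crux is the Hodge
# conjecture in the MIDDLE dimension — certificates for the lead's reshape (line `registered`, c3)

Crux item `stmt-HodgeConjecture-10762` (`HolomorphicityRate.RateGap`). Leads c1/c2 closed the crux's
registered line modulo one stub, `stub_hodgeBelowMiddle` = the Hodge conjecture for all smooth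
projective `X` in codimensions `2 ≤ p ≤ n/2` (cancellation on the ray, `rateGap_of_hodgeBelowMiddle`,
file `HolomorphicityRateRateGapOfHodge`). Lead c3 reshapes that stub with a theorem the tree holds
fully proved — Brosnan–Fang–Nie–Pearlstein 2009, Lemma 48
(`Literature.AlgebraicGeometry.HodgeTheory.middleDimensionReduction_holds`: the Hodge conjecture for
middle-dimensional classes on even-dimensional varieties implies it in every codimension on every
variety) — to `stub_hodgeMiddle`: rational `(m,m)`-classes on smooth projective varieties of even
dimension `2m`, `2 ≤ m`, are algebraic. This file records, as helpers towards the crux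
(`--supports`), the kernel-checked certificates of that reshape:

* `middle_of_hodgeMiddle` — the stub plus the tree (`algebraicClasses_zero` for `m = 0`, Lefschetz
  `(1,1)` `lefschetzOneOne_rational_holds` for `m = 1`) give the middle-dimensional hypothesis of
  `middleDimensionReduction` in every even dimension;
* `hodgeConjecture_of_hodgeMiddle`, `hodgeMiddle_of_hodgeConjecture`, `hodgeConjecture_iff_hodgeMiddle`
  — **the new stub is equivalent to the summit statement `_root_.HodgeConjecture`**;
* `hodgeBelowMiddle_of_hodgeMiddle`, `hodgeConjecture_of_hodgeBelowMiddle`,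
  `hodgeConjecture_iff_hodgeBelowMiddle` — so is the old stub (the fold to every codimension is
  `mem_algebraicClasses_of_hodgeBelowMiddle`, plus `algebraicClasses_zero`,
  `algebraicClasses_eq_top_of_lt` and `nonempty_hodgeModel_holds`), hence old and new stub are
  equivalent (`hodgeBelowMiddle_iff_hodgeMiddle`);
* `rateGap_of_hodgeMiddle` — the crux from the new stub (through `rateGap_of_hodgeConjecture`).

Consequence recorded in the crux's census: the line `registered` is closed modulo exactly the Hodge
conjecture for middle-dimensional rational Hodge classes on smooth projective `2m`-folds, `m ≥ 2`
(fourfolds and up), and no weaker statement in the tree's vocabulary closes it through this line.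

## References

* P. Brosnan, H. Fang, Z. Nie, G. Pearlstein, *Singularities of admissible normal functions*,
  Invent. Math. 177 (2009), §6, Lemma 48 (arXiv:0711.0964, p. 13).
* R. Thomas, *Nodes and the Hodge conjecture*, J. Algebraic Geom. 14 (2005), Prop. 2.
* P. Deligne, *The Hodge conjecture*, Clay problem description (2000), §1.
* C. Voisin, *Hodge Theory and Complex Algebraic Geometry I* (2002), Thm. 11.30.
-/

noncomputable section

open scoped Manifold ContDiff Topology
open Set Filter

set_option linter.dupNamespace false

namespace Summit.HodgeConjecture.HodgeConjecture.Theorems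

open Literature.AlgebraicGeometry.HodgeTheory Literature.AlgebraicGeometry.Motives
  Literature.AlgebraicTopology.SingularHomology Literature.Geometry.Kaehler

/-- **Middle-dimensional Hodge classes in every even dimension, from the middle stub and the tree.**
Granted algebraicity of rational `(m,m)`-classes on smooth projective `2m`-folds for `2 ≤ m` (`hM`,
read in a Hodge model), the middle-dimensional hypothesis of `middleDimensionReduction` holds in every
even dimension: `m = 0` is `algebraicClasses_zero`, `m = 1` (surfaces) is the rational Lefschetz
`(1,1)` theorem `lefschetzOneOne_rational_holds`, and for `m ≥ 2` a Hodge model witnessing the type is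
extracted from `IsOfHodgeType`. [cite: VoisinHodgeI2002, Thm. 11.30] -/
theorem middle_of_hodgeMiddle
    (hM : ∀ (m : ℕ) (X : Literature.AlgebraicGeometry.Motives.SchemeOver ℂ), Literature.AlgebraicGeometry.Motives.IsSmoothProjective (2 * m) X → 2 ≤ m → ∀ (A : Literature.AlgebraicGeometry.HodgeTheory.HodgeModel (2 * m) X) (c : Literature.AlgebraicGeometry.HodgeTheory.complexBetti X (2 * m)), Literature.AlgebraicGeometry.HodgeTheory.IsRationalClass c → A.pullback (2 * m) c ∈ A.hodgePQ (2 * m) m m → c ∈ Literature.AlgebraicGeometry.HodgeTheory.algebraicClasses X m) :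
    ∀ ⦃m : ℕ⦄ ⦃X : Literature.AlgebraicGeometry.Motives.SchemeOver ℂ⦄, Literature.AlgebraicGeometry.Motives.IsSmoothProjective (2 * m) X →
      ∀ c : Literature.AlgebraicGeometry.HodgeTheory.complexBetti X (2 * m), Literature.AlgebraicGeometry.HodgeTheory.IsRationalClass c →
        Literature.AlgebraicGeometry.HodgeTheory.IsOfHodgeType (2 * m) X (2 * m) m m c →
          c ∈ Literature.AlgebraicGeometry.HodgeTheory.algebraicClasses X m := by
  intro m X hX c hc hpp
  rcases Nat.lt_or_ge m 2 with h2 | h2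
  · interval_cases m
    · rw [algebraicClasses_zero]
      exact Submodule.mem_top
    · exact lefschetzOneOne_rational_holds hX c hc hpp
  · obtain ⟨A, hA⟩ := hpp
    exact hM m X hX h2 A c hc hA

/-- **The middle stub implies the Hodge conjecture** (`_root_.HodgeConjecture`, every smooth projective
`X/ℂ`, every codimension): Brosnan–Fang–Nie–Pearlstein 2009 Lemma 48 as discharged in the tree
(`hodgeConjectureFor_of_middleDimension_holds`: products with projective spaces below the middle,
general linear sections and weak Lefschetz above it; Hodge models by `nonempty_hodgeModel_holds`) fed
with `middle_of_hodgeMiddle`. [cite: BrosnanFangNiePearlstein2009, §6 Lemma 48] -/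
theorem hodgeConjecture_of_hodgeMiddle
    (hM : ∀ (m : ℕ) (X : Literature.AlgebraicGeometry.Motives.SchemeOver ℂ), Literature.AlgebraicGeometry.Motives.IsSmoothProjective (2 * m) X → 2 ≤ m → ∀ (A : Literature.AlgebraicGeometry.HodgeTheory.HodgeModel (2 * m) X) (c : Literature.AlgebraicGeometry.HodgeTheory.complexBetti X (2 * m)), Literature.AlgebraicGeometry.HodgeTheory.IsRationalClass c → A.pullback (2 * m) c ∈ A.hodgePQ (2 * m) m m → c ∈ Literature.AlgebraicGeometry.HodgeTheory.algebraicClasses X m) :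
    _root_.HodgeConjecture :=
  fun _ _ hX => hodgeConjectureFor_of_middleDimension_holds (middle_of_hodgeMiddle hM) hX

/-- **The Hodge conjecture implies the middle stub** (specialisation to `n := 2m`, `p := m`, the Hodge
type witnessed by the given model). [cite: Deligne2000, §1] -/
theorem hodgeMiddle_of_hodgeConjecture (hHC : _root_.HodgeConjecture) :
    ∀ (m : ℕ) (X : Literature.AlgebraicGeometry.Motives.SchemeOver ℂ), Literature.AlgebraicGeometry.Motives.IsSmoothProjective (2 * m) X → 2 ≤ m → ∀ (A : Literature.AlgebraicGeometry.HodgeTheory.HodgeModel (2 * m) X) (c : Literature.AlgebraicGeometry.HodgeTheory.complexBetti X (2 * m)), Literature.AlgebraicGeometry.HodgeTheory.IsRationalClass c → A.pullback (2 * m) c ∈ A.hodgePQ (2 * m) m m → c ∈ Literature.AlgebraicGeometry.HodgeTheory.algebraicClasses X m :=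
  fun m _ hX _ A c hc hA => (hHC hX).2 m c hc ⟨A, hA⟩

/-- **Certificate of the reshape: the middle stub of line `registered` is EQUIVALENT to the summit
statement** `_root_.HodgeConjecture` (`hodgeConjecture_of_hodgeMiddle`, BFNP Lemma 48 in the tree;
`hodgeMiddle_of_hodgeConjecture`, specialisation). [cite: BrosnanFangNiePearlstein2009, §6 Lemma 48] -/
theorem hodgeConjecture_iff_hodgeMiddle :
    _root_.HodgeConjecture ↔
      ∀ (m : ℕ) (X : Literature.AlgebraicGeometry.Motives.SchemeOver ℂ), Literature.AlgebraicGeometry.Motives.IsSmoothProjective (2 * m) X → 2 ≤ m → ∀ (A : Literature.AlgebraicGeometry.HodgeTheory.HodgeModel (2 * m) X) (c : Literature.AlgebraicGeometry.HodgeTheory.complexBetti X (2 * m)), Literature.AlgebraicGeometry.HodgeTheory.IsRationalClass c → A.pullback (2 * m) c ∈ A.hodgePQ (2 * m) m m → c ∈ Literature.AlgebraicGeometry.HodgeTheory.algebraicClasses X m :=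
  ⟨hodgeMiddle_of_hodgeConjecture, hodgeConjecture_of_hodgeMiddle⟩

/-- **The old stub from the new one**: the Hodge conjecture in codimensions `2 ≤ p ≤ n/2` (stub
`stub_hodgeBelowMiddle` of leads c1/c2) follows from its middle-dimensional case `2p = n`
(`hodgeConjecture_of_hodgeMiddle`, then specialisation). [cite: BrosnanFangNiePearlstein2009, §6 Lemma 48] -/
theorem hodgeBelowMiddle_of_hodgeMiddle
    (hM : ∀ (m : ℕ) (X : Literature.AlgebraicGeometry.Motives.SchemeOver ℂ), Literature.AlgebraicGeometry.Motives.IsSmoothProjective (2 * m) X → 2 ≤ m → ∀ (A : Literature.AlgebraicGeometry.HodgeTheory.HodgeModel (2 * m) X) (c : Literature.AlgebraicGeometry.HodgeTheory.complexBetti X (2 * m)), Literature.AlgebraicGeometry.HodgeTheory.IsRationalClass c → A.pullback (2 * m) c ∈ A.hodgePQ (2 * m) m m → c ∈ Literature.AlgebraicGeometry.HodgeTheory.algebraicClasses X m) :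
    ∀ (n p : ℕ) (X : Literature.AlgebraicGeometry.Motives.SchemeOver ℂ), Literature.AlgebraicGeometry.Motives.IsSmoothProjective n X → 2 ≤ p → 2 * p ≤ n → ∀ (A : Literature.AlgebraicGeometry.HodgeTheory.HodgeModel n X) (c : Literature.AlgebraicGeometry.HodgeTheory.complexBetti X (2 * p)), Literature.AlgebraicGeometry.HodgeTheory.IsRationalClass c → A.pullback (2 * p) c ∈ A.hodgePQ (2 * p) p p → c ∈ Literature.AlgebraicGeometry.HodgeTheory.algebraicClasses X p :=
  fun _ p _ hX _ _ A c hc hpp => (hodgeConjecture_of_hodgeMiddle hM hX).2 p c hc ⟨A, hpp⟩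

/-- **The old stub implies the Hodge conjecture** (so it was, verbatim up to the tree, the summit): for
`0 < p ≤ n` the fold `mem_algebraicClasses_of_hodgeBelowMiddle` (Lefschetz `(1,1)`, top degree, hard
Lefschetz), for `p = 0` `algebraicClasses_zero`, for `n < p` `algebraicClasses_eq_top_of_lt` (no
cohomology above the top degree), and the Hodge-model conjunct by `nonempty_hodgeModel_holds`.
[cite: Deligne2000, §1] [cite: VoisinHodgeI2002, Thm. 6.25 and Thm. 11.30] -/
theorem hodgeConjecture_of_hodgeBelowMiddle
    (hH : ∀ (n p : ℕ) (X : Literature.AlgebraicGeometry.Motives.SchemeOver ℂ), Literature.AlgebraicGeometry.Motives.IsSmoothProjective n X → 2 ≤ p → 2 * p ≤ n → ∀ (A : Literature.AlgebraicGeometry.HodgeTheory.HodgeModel n X) (c : Literature.AlgebraicGeometry.HodgeTheory.complexBetti X (2 * p)), Literature.AlgebraicGeometry.HodgeTheory.IsRationalClass c → A.pullback (2 * p) c ∈ A.hodgePQ (2 * p) p p → c ∈ Literature.AlgebraicGeometry.HodgeTheory.algebraicClasses X p) :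
    _root_.HodgeConjecture := by
  intro n X hX
  refine ⟨nonempty_hodgeModel_holds hX, fun p c hc hpp => ?_⟩
  rcases Nat.eq_zero_or_pos p with hp0 | hp0
  · subst hp0
    rw [algebraicClasses_zero]
    exact Submodule.mem_top
  rcases le_or_gt p n with hpn | hpn
  · obtain ⟨A, hA⟩ := hpp
    exact mem_algebraicClasses_of_hodgeBelowMiddle hH hX hpn hp0 A c hc hA
  · rw [algebraicClasses_eq_top_of_lt hX hpn]
    exact Submodule.mem_top

/-- **Certificate: the old stub of line `registered` is EQUIVALENT to the summit statement**
`_root_.HodgeConjecture`. [cite: Deligne2000, §1] -/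
theorem hodgeConjecture_iff_hodgeBelowMiddle :
    _root_.HodgeConjecture ↔
      ∀ (n p : ℕ) (X : Literature.AlgebraicGeometry.Motives.SchemeOver ℂ), Literature.AlgebraicGeometry.Motives.IsSmoothProjective n X → 2 ≤ p → 2 * p ≤ n → ∀ (A : Literature.AlgebraicGeometry.HodgeTheory.HodgeModel n X) (c : Literature.AlgebraicGeometry.HodgeTheory.complexBetti X (2 * p)), Literature.AlgebraicGeometry.HodgeTheory.IsRationalClass c → A.pullback (2 * p) c ∈ A.hodgePQ (2 * p) p p → c ∈ Literature.AlgebraicGeometry.HodgeTheory.algebraicClasses X p :=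
  ⟨fun hHC _ p _ hX _ _ A c hc hpp => (hHC hX).2 p c hc ⟨A, hpp⟩, hodgeConjecture_of_hodgeBelowMiddle⟩

/-- **Old and new stub are equivalent** (both are the Hodge conjecture):
`stub_hodgeBelowMiddle ↔ stub_hodgeMiddle`. [cite: BrosnanFangNiePearlstein2009, §6 Lemma 48] -/
theorem hodgeBelowMiddle_iff_hodgeMiddle :
    (∀ (n p : ℕ) (X : Literature.AlgebraicGeometry.Motives.SchemeOver ℂ), Literature.AlgebraicGeometry.Motives.IsSmoothProjective n X → 2 ≤ p → 2 * p ≤ n → ∀ (A : Literature.AlgebraicGeometry.HodgeTheory.HodgeModel n X) (c : Literature.AlgebraicGeometry.HodgeTheory.complexBetti X (2 * p)), Literature.AlgebraicGeometry.HodgeTheory.IsRationalClass c → A.pullback (2 * p) c ∈ A.hodgePQ (2 * p) p p → c ∈ Literature.AlgebraicGeometry.HodgeTheory.algebraicClasses X p) ↔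
      ∀ (m : ℕ) (X : Literature.AlgebraicGeometry.Motives.SchemeOver ℂ), Literature.AlgebraicGeometry.Motives.IsSmoothProjective (2 * m) X → 2 ≤ m → ∀ (A : Literature.AlgebraicGeometry.HodgeTheory.HodgeModel (2 * m) X) (c : Literature.AlgebraicGeometry.HodgeTheory.complexBetti X (2 * m)), Literature.AlgebraicGeometry.HodgeTheory.IsRationalClass c → A.pullback (2 * m) c ∈ A.hodgePQ (2 * m) m m → c ∈ Literature.AlgebraicGeometry.HodgeTheory.algebraicClasses X m :=
  ⟨fun hH => hodgeMiddle_of_hodgeConjecture (hodgeConjecture_of_hodgeBelowMiddle hH),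
    hodgeBelowMiddle_of_hodgeMiddle⟩

/-- **The crux `RateGap` from the middle stub** (`hodgeConjecture_of_hodgeMiddle`, then the landed
`rateGap_of_hodgeConjecture`: cancellation on the ray over a holomorphic cycle support). This is the
skeleton theorem `RateGap_of` of line `registered` after the c3 reshape, with its one stub as a
hypothesis. [cite: BrosnanFangNiePearlstein2009, §6 Lemma 48] [cite: Deligne2000, §1] -/
theorem rateGap_of_hodgeMiddle : (∀ (m : ℕ) (X : Literature.AlgebraicGeometry.Motives.SchemeOver ℂ), Literature.AlgebraicGeometry.Motives.IsSmoothProjective (2 * m) X → 2 ≤ m → ∀ (A : Literature.AlgebraicGeometry.HodgeTheory.HodgeModel (2 * m) X) (c : Literature.AlgebraicGeometry.HodgeTheory.complexBetti X (2 * m)), Literature.AlgebraicGeometry.HodgeTheory.IsRationalClass c → A.pullback (2 * m) c ∈ A.hodgePQ (2 * m) m m → c ∈ Literature.AlgebraicGeometry.HodgeTheory.algebraicClasses X m) → Summit.HodgeConjecture.HodgeConjecture.Theses.HolomorphicityRate.RateGap :=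
  fun hM => rateGap_of_hodgeConjecture (hodgeConjecture_of_hodgeMiddle hM)

end Summit.HodgeConjecture.HodgeConjecture.Theorems

end
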